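import Summits.ResolutionOfSingularities.ResolutionOfSingularities.Theorems.EquisingularLiftEquisingularLiftNatNDStrataTower
import Literature.AlgebraicGeometry.Resolution.MarkedIdeals
import HarnessLib

/-!
# [OURS · L1 W4.5(b) · EL♮(3)] ND INVARIANTS — `…NatNDInvariants` (desk R31 (β) DEAL «ND-K5»; desk ruling 2026-08-28T14:00:08Z «INVARIANT FREEZE ADVANCED TO NOW»):
# (B3c) `ND.hsub_of_invariant` / `ND.hsub_strataLift_of_invariant` (HSUB(ReachToric) from ANY upstairs invariant with init / `StratumFacts` / `StepFacts`, PROVED),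
# §13.7 the candidate UPSTAIRS invariant `ND.SNCInv` (clause bricks (B3a) `sncInv_init` res-type-027 · (B3g) `sncInv_stratumFacts` res-L1-w45b-stub-4 · (B3b)
# `sncInv_stepFacts` res-L1-w45b-stub-2), §13.10 the candidate DOWNSTAIRS invariant `ND.NDInv` with `ND.baseToStalk`, `ND.IsNDFrameAt`, `ND.isFrameAt_of_isNDFrameAt`,
# (B4-end) `ND.ndInv_end` PROVED (clause bricks (B4-init) `ndInv_init` res-type-027), §13.12 the (B4-round) SPLIT `ND.RoundAtNDFrame` (B4α′, lead-2 ND lane) /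
# `ND.NDInvPersists` (B4β′), `ND.NDInvC`, `ND.ndInvC_end`, and the composition `ND.ndInv_round_of` PROVED

OURS · L1 W4.5(b) · EL♮(3) stmt-ResolutionOfSingularities-20148 (parent EL♮ stmt-…-20038) · counted 0 · AI-written (res-L1-w45b-idea-1 g23: PORT DRAFT v2
`Cruxes/EquisingularLiftNatThree/NDStrataTowerPortDraft.lean` sha16 14c3fe31c4a9879b = SPEC `NewtonNondegenerateRungK5.lean` v5 9f8a515d4ef8f685 §13.6-tail / §13.7 / §13.10 /
§13.12 VERBATIM; ported by the text owner res-L1-w45b-lead-2 g6 — §13.1/§13.5/§13.6/§13.9 are `…NatNDStrataTower` p638808), weaker than expert review; nothing of [Hironaka2017]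
asserted; no statement of the manuscript. Definitions + PROVED pure plumbing (no `sorry`, no instance, no notation; standard axioms). `--kind definition --supports
stmt-ResolutionOfSingularities-20148 --as helper`: support module toward the registered 4th CHILD stub `stub_elnat_three_isolated_newtonNondegenerate` — the chain's first
BY-NAME closure target: the six clause bricks (B3a)/(B3g)/(B3b)/(B4-init)/(B4α′)/(B4β′) close against THESE declarations (namespace `…Sections.ND`, names = the spec's), then
(B3) `hsub_strataLift` := `hsub_strataLift_of_invariant … SNCInv …`, (B4) `hres_toricRounds` := `hres_of_rounds … NDInvC …`, the rung through K5′. RULE (desk): an amendment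
of an invariant after this landing = a NEW def name (`SNCInv₂`, …) in a new defs module + re-targeted bricks, never an in-place edit (the iterations are parametric).
-/

set_option linter.dupNamespace false
set_option linter.overlappingInstances false -- K5′-style signatures carry `[IsDomain O] [IsDiscreteValuationRing O]`

noncomputable section

open CategoryTheory CategoryTheory.Limits AlgebraicGeometry TopologicalSpace Topology
open MvPolynomial
open Literature.AlgebraicGeometry.Resolution
open AlgebraicGeometry.Scheme.IdealSheafData

namespace Summit.ResolutionOfSingularities.ResolutionOfSingularities.Cruxes.EquisingularLiftNat.Sections.ND

open Summit.ResolutionOfSingularities.ResolutionOfSingularities.Cruxes.EquisingularLiftNat.Sections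

variable {n : ℕ}

/-- **(B3c) `hsub_of_invariant` — HSUB(ReachToric) FROM AN INVARIANT, PROVED.**  In K5′'s engine context after the point step, ANY predicate `G` on
(upstairs stage, model, upstairs boundary, downstairs boundary) that (B3a) holds for SOME upstairs boundary `Ẽ₁` on `X₁ = Bl_{ker s} X'` over the stepped
frame boundary of every frame at `x`, (B3g) yields the four centre facts, (B3b) survives strata steps, gives the conclusion of HSUB(ReachToric) for every
`ReachToric`-admissible sub-chain.  So (B3) `hsub_strataLift` = «exhibit `G`» — the intended `G` is the SNC invariant «`F` :: frame lifts :: exceptionals is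
SNC near the section's fibre, with the right stalks under `jm`» (module docstring).  [OURS · L1 W4.5b · PROVED; pure logic over `strataTower_lift`] -/
theorem hsub_of_invariant (k : Type) [Field k] (n : ℕ)
    (O : Type) [CommRing O] [IsDomain O] [IsDiscreteValuationRing O] (θ : O →+* k) (hθ : Function.Surjective θ)
    (P : Scheme.{0}) (q : P ⟶ Spec (.of O)) (Y : Set P) (Ch : ∀ X' : Scheme.{0}, (X' ⟶ P) → Set X' → Prop)
    (hStep : ∀ (X' X'' : Scheme.{0}) (σ' : X' ⟶ P) (S' : Set X') (C : X'.IdealSheafData) (τ : X'' ⟶ X'),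
      Ch X' σ' S' → IsBlowup τ C → Scheme.IsRegular C.subscheme → Flat (C.subschemeι ≫ σ' ≫ q) →
      σ' '' (C.support : Set X') ⊆ {x : P | ¬ IsGenericPoint x Y} →
      (C.support : Set X') ∩ (σ' ≫ q) ⁻¹' {IsLocalRing.closedPoint O} ⊆ S' →
      Ch X'' (τ ≫ σ') (closure (τ ⁻¹' (S' \ (C.support : Set X')))))
    (hChain : ∀ (X' : Scheme.{0}) (σ : X' ⟶ P) (S : Set X'), Ch X' σ S →
      Summit.ResolutionOfSingularities.ResolutionOfSingularities.Theses.EquisingularLift.Split.Chain P Y X' σ S)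
    (hYirr : IsIrreducible Y) (hYcl : IsClosed Y)
    -- the stage after the point step and the model of `F₂`
    (X₁ : Scheme.{0}) (σ₁ : X₁ ⟶ P) (hCh₁int : IsIntegral X₁) (hX₁n : IsLocallyNoetherian X₁) (hX₁r : Scheme.IsRegular X₁)
    (hX₁dom : IsDominant (σ₁ ≫ q))
    (F₁ F₂ : Scheme.{0}) (hF₂ : IsIntegral F₂) (υ : F₂ ⟶ F₁) (x : F₁) (T₂ : Set F₂) (hT₂cl : IsClosed T₂) (hT₂irr : IsIrreducible T₂)
    (j₂ : F₂ ⟶ X₁) (t₂ : F₂ ⟶ Spec (.of k)) (hsq₂ : IsPullback j₂ t₂ (σ₁ ≫ q) (Spec.map (CommRingCat.ofHom θ)))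
    (hCh₁ : Ch X₁ σ₁ (j₂ '' T₂))
    -- the invariant and its three clauses
    (G : ∀ (X : Scheme.{0}) (_ : X ⟶ P) (F : Scheme.{0}) (_ : F ⟶ X), Boundary n X → Boundary n F → Prop)
    (hinit : ∀ (hx : IsClosed ({x} : Set F₁)) (W : Fin n → F₁.IdealSheafData), IsFrameAt W x →
      ∃ EX₁ : Boundary n X₁, G X₁ σ₁ F₂ j₂ EX₁ ((frameBoundary W).stepAlong (vanishingIdeal (⟨{x}, hx⟩ : Closeds F₁)) 1 υ))
    (hstrat : StratumFacts (n := n) O k θ P q Y Ch G) (hstep : StepFacts (n := n) O k θ P q Ch G)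
    (F₉ : Scheme.{0}) (β : F₉ ⟶ F₂) (T₉ : Set F₉) (hR : ReachToric n F₁ F₂ υ x T₂ F₉ β T₉) :
    ∃ (X₉ : Scheme.{0}) (σ₉ : X₉ ⟶ P) (S₉ : Set X₉) (j₉ : F₉ ⟶ X₉) (t₉ : F₉ ⟶ Spec (.of k)),
      Ch X₉ σ₉ S₉ ∧ IsIntegral X₉ ∧ IsLocallyNoetherian X₉ ∧ Scheme.IsRegular X₉ ∧ IsDominant (σ₉ ≫ q) ∧
      IsPullback j₉ t₉ (σ₉ ≫ q) (Spec.map (CommRingCat.ofHom θ)) ∧ j₉ '' T₉ = S₉ ∧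
      IsClosed T₉ ∧ IsIrreducible T₉ ∧ IsIntegral F₉ := by
  obtain ⟨hx, W, hW, htower⟩ := hR
  obtain ⟨EX₁, hG₁⟩ := hinit hx W hW
  exact strataTower_lift (n := n) O k θ P q Y Ch hθ hYirr hYcl hChain hStep G hstrat hstep htower X₁ σ₁ (j₂ '' T₂) j₂ t₂ EX₁
    ⟨hCh₁, hCh₁int, hX₁n, hX₁r, hX₁dom, hF₂, hsq₂, rfl, hT₂cl, hT₂irr⟩ hG₁

/-- **(B3) ⟸ «exhibit an invariant»**: the brick `hsub_strataLift` (K5′'s HSUB block at `ReachToric`) follows from ANY assignment, to each point-step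
context K5′ hands over (ALL its binders up to `Ch X₁ (τ₁ ≫ σ') (j₂ '' T₂)` — in particular the model squares `j`, `j₂`, the section `s` with `s(𝔪) = j x` and
T-DIM, `τ₁ = Bl_{ker s}`, `j₂ ≫ τ₁ = υ ≫ j`, the carrier identity), of an invariant `G` with the three clauses (B3a) init / (B3g) `StratumFacts` / (B3b)
`StepFacts`.  [OURS · L1 W4.5b · PROVED; pure logic over `hsub_of_invariant`] -/
theorem hsub_strataLift_of_invariant (k : Type) [Field k] (n : ℕ)
    (hGfam :
    (∀ (O : Type) [CommRing O] [IsDomain O] [IsDiscreteValuationRing O] [IsAdicComplete (IsLocalRing.maximalIdeal O) O]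
        [IsAlgClosed (IsLocalRing.ResidueField O)] (θ : O →+* k), Function.Surjective θ →
      ∀ (P : AlgebraicGeometry.Scheme.{0}) (q : P ⟶ AlgebraicGeometry.Spec (.of O)) (Y : Set P)
        (Ch : ∀ X' : AlgebraicGeometry.Scheme.{0}, (X' ⟶ P) → Set X' → Prop),
        (∀ (X' X'' : AlgebraicGeometry.Scheme.{0}) (σ' : X' ⟶ P) (S' : Set X') (C : X'.IdealSheafData) (τ : X'' ⟶ X'),
          Ch X' σ' S' → Literature.AlgebraicGeometry.Resolution.IsBlowup τ C →
          Literature.AlgebraicGeometry.Resolution.Scheme.IsRegular C.subscheme → AlgebraicGeometry.Flat (C.subschemeι ≫ σ' ≫ q) →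
          σ' '' (C.support : Set X') ⊆ {y | ¬ IsGenericPoint y Y} →
          (C.support : Set X') ∩ (σ' ≫ q) ⁻¹' {IsLocalRing.closedPoint O} ⊆ S' →
          Ch X'' (τ ≫ σ') (closure (τ ⁻¹' (S' \ (C.support : Set X'))))) →
        (∀ (X' : AlgebraicGeometry.Scheme.{0}) (σ' : X' ⟶ P) (S' : Set X'), Ch X' σ' S' →
          Summit.ResolutionOfSingularities.ResolutionOfSingularities.Theses.EquisingularLift.Split.Chain P Y X' σ' S') →
        Y ⊆ q ⁻¹' {IsLocalRing.closedPoint O} → IsIrreducible Y → IsClosed Y →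
        AlgebraicGeometry.IsIntegral P → IsLocallyNoetherian P → Literature.AlgebraicGeometry.Resolution.Scheme.IsRegular P →
        AlgebraicGeometry.IsProper q → AlgebraicGeometry.SmoothOfRelativeDimension n q →
      -- the stage before the point step and its model
      ∀ (X' : AlgebraicGeometry.Scheme.{0}) (σ' : X' ⟶ P) (S' : Set X'), Ch X' σ' S' → AlgebraicGeometry.IsIntegral X' →
        IsLocallyNoetherian X' → Literature.AlgebraicGeometry.Resolution.Scheme.IsRegular X' →
        AlgebraicGeometry.IsDominant (σ' ≫ q) →
      ∀ (F₁ : AlgebraicGeometry.Scheme.{0}), AlgebraicGeometry.IsIntegral F₁ → ∀ (j : F₁ ⟶ X')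
        (t : F₁ ⟶ AlgebraicGeometry.Spec (.of k)),
        IsPullback j t (σ' ≫ q) (AlgebraicGeometry.Spec.map (CommRingCat.ofHom θ)) →
      ∀ (T₁ : Set F₁), IsClosed T₁ → IsIrreducible T₁ → j '' T₁ = S' →
      -- the point step: section, its blow-up, the new stage and its model
      ∀ (x : F₁) (hx : IsClosed ({x} : Set F₁)) (U : X'.Opens), AlgebraicGeometry.Smooth (U.ι ≫ σ' ≫ q) →
      ∀ (s : AlgebraicGeometry.Spec (.of O) ⟶ X'), s ≫ σ' ≫ q = 𝟙 _ → s (IsLocalRing.closedPoint O) ∈ U →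
        s (IsLocalRing.closedPoint O) = j x →
        ringKrullDim (X'.presheaf.stalk (s (IsLocalRing.closedPoint O))) = ((n + 1 : ℕ) : WithBot ℕ∞) →
        IsRegularLocalRing (F₁.presheaf.stalk x) →
        (∀ c ∈ (s.ker.support : Set X'), ¬ IsGenericPoint (σ' c) Y) →
      ∀ (X₁ : AlgebraicGeometry.Scheme.{0}) (τ₁ : X₁ ⟶ X'), Literature.AlgebraicGeometry.Resolution.IsBlowup τ₁ s.ker →
        AlgebraicGeometry.IsIntegral X₁ → IsLocallyNoetherian X₁ → Literature.AlgebraicGeometry.Resolution.Scheme.IsRegular X₁ →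
        AlgebraicGeometry.IsDominant ((τ₁ ≫ σ') ≫ q) →
      ∀ (F₂ : AlgebraicGeometry.Scheme.{0}), AlgebraicGeometry.IsIntegral F₂ → ∀ (υ : F₂ ⟶ F₁),
        Literature.AlgebraicGeometry.Resolution.IsBlowup υ
          (AlgebraicGeometry.Scheme.IdealSheafData.vanishingIdeal (⟨{x}, hx⟩ : TopologicalSpace.Closeds F₁)) →
      ∀ (j₂ : F₂ ⟶ X₁) (t₂ : F₂ ⟶ AlgebraicGeometry.Spec (.of k)),
        IsPullback j₂ t₂ ((τ₁ ≫ σ') ≫ q) (AlgebraicGeometry.Spec.map (CommRingCat.ofHom θ)) → j₂ ≫ τ₁ = υ ≫ j →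
        (s.ker.comap τ₁).comap j₂ =
          (AlgebraicGeometry.Scheme.IdealSheafData.vanishingIdeal (⟨{x}, hx⟩ : TopologicalSpace.Closeds F₁)).comap υ →
        IsIrreducible (closure (υ ⁻¹' (T₁ \ {x}))) →
        Ch X₁ (τ₁ ≫ σ') (j₂ '' closure (υ ⁻¹' (T₁ \ {x}))) →
      ∃ G : ∀ (X : AlgebraicGeometry.Scheme.{0}) (_ : X ⟶ P) (F : AlgebraicGeometry.Scheme.{0}) (_ : F ⟶ X), Boundary n X → Boundary n F → Prop,
        (∀ (hx' : IsClosed ({x} : Set F₁)) (W : Fin n → F₁.IdealSheafData), IsFrameAt W x →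
          ∃ EX₁ : Boundary n X₁, G X₁ (τ₁ ≫ σ') F₂ j₂ EX₁
            ((frameBoundary W).stepAlong (AlgebraicGeometry.Scheme.IdealSheafData.vanishingIdeal (⟨{x}, hx'⟩ : TopologicalSpace.Closeds F₁)) 1 υ)) ∧
        StratumFacts (n := n) O k θ P q Y Ch G ∧ StepFacts (n := n) O k θ P q Ch G)) :
    (∀ (O : Type) [CommRing O] [IsDomain O] [IsDiscreteValuationRing O] [IsAdicComplete (IsLocalRing.maximalIdeal O) O]
        [IsAlgClosed (IsLocalRing.ResidueField O)] (θ : O →+* k), Function.Surjective θ →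
      ∀ (P : AlgebraicGeometry.Scheme.{0}) (q : P ⟶ AlgebraicGeometry.Spec (.of O)) (Y : Set P)
        (Ch : ∀ X' : AlgebraicGeometry.Scheme.{0}, (X' ⟶ P) → Set X' → Prop),
        (∀ (X' X'' : AlgebraicGeometry.Scheme.{0}) (σ' : X' ⟶ P) (S' : Set X') (C : X'.IdealSheafData) (τ : X'' ⟶ X'),
          Ch X' σ' S' → Literature.AlgebraicGeometry.Resolution.IsBlowup τ C →
          Literature.AlgebraicGeometry.Resolution.Scheme.IsRegular C.subscheme → AlgebraicGeometry.Flat (C.subschemeι ≫ σ' ≫ q) →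
          σ' '' (C.support : Set X') ⊆ {y | ¬ IsGenericPoint y Y} →
          (C.support : Set X') ∩ (σ' ≫ q) ⁻¹' {IsLocalRing.closedPoint O} ⊆ S' →
          Ch X'' (τ ≫ σ') (closure (τ ⁻¹' (S' \ (C.support : Set X'))))) →
        (∀ (X' : AlgebraicGeometry.Scheme.{0}) (σ' : X' ⟶ P) (S' : Set X'), Ch X' σ' S' →
          Summit.ResolutionOfSingularities.ResolutionOfSingularities.Theses.EquisingularLift.Split.Chain P Y X' σ' S') →
        Y ⊆ q ⁻¹' {IsLocalRing.closedPoint O} → IsIrreducible Y → IsClosed Y →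
        AlgebraicGeometry.IsIntegral P → IsLocallyNoetherian P → Literature.AlgebraicGeometry.Resolution.Scheme.IsRegular P →
        AlgebraicGeometry.IsProper q → AlgebraicGeometry.SmoothOfRelativeDimension n q →
      -- the stage before the point step and its model
      ∀ (X' : AlgebraicGeometry.Scheme.{0}) (σ' : X' ⟶ P) (S' : Set X'), Ch X' σ' S' → AlgebraicGeometry.IsIntegral X' →
        IsLocallyNoetherian X' → Literature.AlgebraicGeometry.Resolution.Scheme.IsRegular X' →
        AlgebraicGeometry.IsDominant (σ' ≫ q) →
      ∀ (F₁ : AlgebraicGeometry.Scheme.{0}), AlgebraicGeometry.IsIntegral F₁ → ∀ (j : F₁ ⟶ X')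
        (t : F₁ ⟶ AlgebraicGeometry.Spec (.of k)),
        IsPullback j t (σ' ≫ q) (AlgebraicGeometry.Spec.map (CommRingCat.ofHom θ)) →
      ∀ (T₁ : Set F₁), IsClosed T₁ → IsIrreducible T₁ → j '' T₁ = S' →
      -- the point step: section, its blow-up, the new stage and its model
      ∀ (x : F₁) (hx : IsClosed ({x} : Set F₁)) (U : X'.Opens), AlgebraicGeometry.Smooth (U.ι ≫ σ' ≫ q) →
      ∀ (s : AlgebraicGeometry.Spec (.of O) ⟶ X'), s ≫ σ' ≫ q = 𝟙 _ → s (IsLocalRing.closedPoint O) ∈ U →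
        s (IsLocalRing.closedPoint O) = j x →
        ringKrullDim (X'.presheaf.stalk (s (IsLocalRing.closedPoint O))) = ((n + 1 : ℕ) : WithBot ℕ∞) →
        IsRegularLocalRing (F₁.presheaf.stalk x) →
        (∀ c ∈ (s.ker.support : Set X'), ¬ IsGenericPoint (σ' c) Y) →
      ∀ (X₁ : AlgebraicGeometry.Scheme.{0}) (τ₁ : X₁ ⟶ X'), Literature.AlgebraicGeometry.Resolution.IsBlowup τ₁ s.ker →
        AlgebraicGeometry.IsIntegral X₁ → IsLocallyNoetherian X₁ → Literature.AlgebraicGeometry.Resolution.Scheme.IsRegular X₁ →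
        AlgebraicGeometry.IsDominant ((τ₁ ≫ σ') ≫ q) →
      ∀ (F₂ : AlgebraicGeometry.Scheme.{0}), AlgebraicGeometry.IsIntegral F₂ → ∀ (υ : F₂ ⟶ F₁),
        Literature.AlgebraicGeometry.Resolution.IsBlowup υ
          (AlgebraicGeometry.Scheme.IdealSheafData.vanishingIdeal (⟨{x}, hx⟩ : TopologicalSpace.Closeds F₁)) →
      ∀ (j₂ : F₂ ⟶ X₁) (t₂ : F₂ ⟶ AlgebraicGeometry.Spec (.of k)),
        IsPullback j₂ t₂ ((τ₁ ≫ σ') ≫ q) (AlgebraicGeometry.Spec.map (CommRingCat.ofHom θ)) → j₂ ≫ τ₁ = υ ≫ j →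
        (s.ker.comap τ₁).comap j₂ =
          (AlgebraicGeometry.Scheme.IdealSheafData.vanishingIdeal (⟨{x}, hx⟩ : TopologicalSpace.Closeds F₁)).comap υ →
        IsIrreducible (closure (υ ⁻¹' (T₁ \ {x}))) →
        Ch X₁ (τ₁ ≫ σ') (j₂ '' closure (υ ⁻¹' (T₁ \ {x}))) →
      -- the admissible downstairs sub-chains are matched upstairs
      ∀ (F₉ : AlgebraicGeometry.Scheme.{0}) (β : F₉ ⟶ F₂) (T₉ : Set F₉), ReachToric n F₁ F₂ υ x (closure (υ ⁻¹' (T₁ \ {x}))) F₉ β T₉ →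
        ∃ (X₉ : AlgebraicGeometry.Scheme.{0}) (σ₉ : X₉ ⟶ P) (S₉ : Set X₉) (j₉ : F₉ ⟶ X₉)
          (t₉ : F₉ ⟶ AlgebraicGeometry.Spec (.of k)),
          Ch X₉ σ₉ S₉ ∧ AlgebraicGeometry.IsIntegral X₉ ∧ IsLocallyNoetherian X₉ ∧
          Literature.AlgebraicGeometry.Resolution.Scheme.IsRegular X₉ ∧ AlgebraicGeometry.IsDominant (σ₉ ≫ q) ∧
          IsPullback j₉ t₉ (σ₉ ≫ q) (AlgebraicGeometry.Spec.map (CommRingCat.ofHom θ)) ∧ j₉ '' T₉ = S₉ ∧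
          IsClosed T₉ ∧ IsIrreducible T₉ ∧ AlgebraicGeometry.IsIntegral F₉) := by
  intro O _ _ _ _ _ θ hθ P q Y Ch hStep hChain hYq hYirr hYcl hPint hPn hPreg hqpr hqsm X' σ' S' hCh hX'i hX'n hX'r hdom F₁ hF₁ j t hsq
    T₁ hT₁cl hT₁irr hjT x hx U hU s hs hsU hsx hdim hregx hoffs X₁ τ₁ hτ₁ hX₁i hX₁n hX₁r hX₁dom F₂ hF₂ υ hυ j₂ t₂ hsq₂ hcomm hcarr
    hT₂irr hCh₁ F₉ β T₉ hR
  obtain ⟨G, hinit, hstrat, hstep⟩ :=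
    hGfam O θ hθ P q Y Ch hStep hChain hYq hYirr hYcl hPint hPn hPreg hqpr hqsm X' σ' S' hCh hX'i hX'n hX'r hdom F₁ hF₁ j t hsq
      T₁ hT₁cl hT₁irr hjT x hx U hU s hs hsU hsx hdim hregx hoffs X₁ τ₁ hτ₁ hX₁i hX₁n hX₁r hX₁dom F₂ hF₂ υ hυ j₂ t₂ hsq₂ hcomm hcarr
      hT₂irr hCh₁
  exact hsub_of_invariant k n O θ hθ P q Y Ch hStep hChain hYirr hYcl X₁ (τ₁ ≫ σ') hX₁i hX₁n hX₁r hX₁dom F₁ F₂ hF₂ υ x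
    (closure (υ ⁻¹' (T₁ \ {x}))) isClosed_closure hT₂irr j₂ t₂ hsq₂ hCh₁ G hinit hstrat hstep F₉ β T₉ hR

/-! ## 13.7 (B3a)/(B3g)/(B3b) — the CANDIDATE invariant `SNCInv` (idea-1's proposal; the O-side owners may refine it, `hsub_strataLift_of_invariant` accepts
any `G`), its three clauses as the bricks to prove, and (B3) `hsub_strataLift` DERIVED from them -/

section Invariant

variable (P : Scheme.{0}) (Y : Set P)

/-- **`SNCInv`** — «the special fibre and the present boundary members are SNC near the upstairs exceptional locus, and the two floors' boundaries match under
the model `jm`».  Data: an open `U ⊆ X` and a finite set `R` of PRESENT rays.  Clauses: (a) absent rays carry `⊤` on both floors; (b) for every present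
NON-FRAME ray, the upstairs divisor's support lies in `U` and off the generic point of `Y` (it lies over the section, `off_generic_of_subset_preimage`);
(c) on `U`, `jm.ker ∣_U` (the special fibre `F = V(ϖ)`) `::` the present members is an SNC family (`Literature…HasSNC`; so `ϖ` is a parameter TRANSVERSAL to
every stratum — the source of `O`-flatness over the DVR), no present member coinciding with the fibre on `U`; (d) MODEL COMPATIBILITY: present non-frame rays
EXACTLY (`(EX ρ)·𝒪_F = E ρ` — true by the carrier identity at creation and by the SNC chart formulas `ChartData.stalkIdeal_strictTransform_w/_x` under
later steps), frame rays on STALKS at the points of the downstairs exceptional locus (the frame lifts agree with the frame only near `x`).  From (a)–(d):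
`StratumFacts` by `isRegular_subscheme_finsetSup` (on `U`), DVR-flatness from transversality (companion §12.17 `flat_specMap_quot_span_X` is the chart form),
`comap_finsetSup` + `stalkIdeal_finsetSup` + `le_of_forall_stalkIdeal_le`, and (b); `StepFacts` by `HasSNCWith.hasSNC_transform` on `τX ∣_ U`
(`IsBlowup.restrict`) with `U₂ := τX⁻¹ U`.  [OURS · L1 W4.5b · CANDIDATE definition] -/
def SNCInv (X : Scheme.{0}) (σ : X ⟶ P) (F : Scheme.{0}) (jm : F ⟶ X) (EX : Boundary n X) (E : Boundary n F) : Prop :=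
  ∃ (U : X.Opens) (R : Finset (Ray n)),
    -- (a) absent rays
    (∀ ρ, ρ ∉ R → EX ρ = ⊤ ∧ E ρ = ⊤) ∧
    -- (b) the upstairs exceptional locus lies in `U` and off the generic point of `Y`
    (∀ ρ ∈ R, ρ ∉ Set.range (e n) →
      ((EX ρ).support : Set X) ⊆ (U : Set X) ∧ σ '' ((EX ρ).support : Set X) ⊆ {y : P | ¬ IsGenericPoint y Y}) ∧
    -- (c) SNC on `U` of «special fibre :: present members», the fibre being none of the members
    HasSNC ((jm.ker.comap U.ι) :: (R.toList.map fun ρ => (EX ρ).comap U.ι)) ∧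
    (∀ ρ ∈ R, (EX ρ).comap U.ι ≠ jm.ker.comap U.ι) ∧
    -- (d) model compatibility of the two floors
    (∀ ρ ∈ R, ρ ∉ Set.range (e n) → (EX ρ).comap jm = E ρ) ∧
    (∀ (i : Fin n) (y : F), (∃ ρ ∈ R, ρ ∉ Set.range (e n) ∧ y ∈ ((E ρ).support : Set F)) →
      stalkIdeal ((EX (e n i)).comap jm) y = stalkIdeal (E (e n i)) y)

end Invariant

/-! ## 13.10 (B4, ROUND 10 preview) THE CANDIDATE DOWNSTAIRS INVARIANT `NDInv` and its clauses (B4-init) / (B4-end, PROVED) / (B4-round)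

`NDInv m F ρ T`: the ambient floor `F` is regular, and the reduced closure `T̂` of `T` has EXACTLY the finite set `S` (`|S| = m`) of non-regular points, each a
closed point carrying LOCAL ND FRAME DATA (`IsNDFrameAt`): a frame `W` with stalk generators `w₁,…,wₙ` (an r.s.p. of `𝒪_{F,x}`, `dim = n`) and a polynomial
`g ∈ LocalNDWon` (tree `…Sections.LocalNDWon`: convenient + locally Newton-nondegenerate + a WON E1-legal play) with `(𝓘_T̂)_x = (g(w))`, coefficients through the
structure map `k → 𝒪_{F,x}` of the `ℙⁿ_k`-scheme `F` (`baseToStalk`).  GERM-level like `IsFrameAt` (the étale chart `V → 𝔸ⁿ_k`, `t ↦ w`, is DERIVED by the provers: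
`Literature.AlgebraicGeometry.Resolution.localRingHom_flat_and_formallyUnramified` is the field-case template).  The k-side owner may strengthen `NDInv`
(e.g. add `IsIntegral F`, `IsLocallyNoetherian F`) without touching §13.9. -/

section NDInvariant

variable (n : ℕ) (k : Type) [Field k]

/-- The structure map `k → 𝒪_{F,x}` of a scheme `ρ : F → ℙⁿ_k` over `ℙⁿ_k` (through global sections of `Spec k` and the germ at `x`). [OURS · plumbing] -/
noncomputable def baseToStalk {F : AlgebraicGeometry.Scheme.{0}} (ρ : F ⟶ (Literature.AlgebraicGeometry.Motives.projectiveSpace n k).left) (x : F) : k →+* (F.presheaf.stalk x : Type _) :=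
  (F.presheaf.germ ⊤ x trivial).hom.comp
    (((ρ ≫ (Literature.AlgebraicGeometry.Motives.projectiveSpace n k).hom).appTop).hom.comp
      (AlgebraicGeometry.Scheme.ΓSpecIso (CommRingCat.of k)).inv.hom)

/-- **LOCAL ND FRAME DATA at `x`** for `(F, ρ, T)` and a frame `W`: stalk generators `w` of the `W j` forming an r.s.p. of the `n`-dimensional `𝒪_{F,x}`, and
`g ∈ LocalNDWon` with `(𝓘_{closure T, red})_x = (g(w))`.  Implies `IsFrameAt W x` (`isFrameAt_of_isNDFrameAt`). [OURS · L1 W4.5b · definition] -/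
def IsNDFrameAt {F : AlgebraicGeometry.Scheme.{0}} (ρ : F ⟶ (Literature.AlgebraicGeometry.Motives.projectiveSpace n k).left) (T : Set F) (W : Fin n → F.IdealSheafData) (x : F) : Prop :=
  ∃ (w : Fin n → F.presheaf.stalk x) (g : MvPolynomial (Fin n) k),
    (∀ j, stalkIdeal (W j) x = Ideal.span {w j}) ∧
    Ideal.span (Set.range w) = IsLocalRing.maximalIdeal (F.presheaf.stalk x) ∧
    ringKrullDim (F.presheaf.stalk x) = (n : WithBot ℕ∞) ∧
    LocalNDWon g ∧
    stalkIdeal (AlgebraicGeometry.Scheme.IdealSheafData.vanishingIdeal (⟨closure T, isClosed_closure⟩ : TopologicalSpace.Closeds F)) x = Ideal.span {MvPolynomial.eval₂ (baseToStalk n k ρ x) w g}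

/-- Local ND frame data contain frame data. [OURS · pure logic] -/
theorem isFrameAt_of_isNDFrameAt {F : AlgebraicGeometry.Scheme.{0}} {ρ : F ⟶ (Literature.AlgebraicGeometry.Motives.projectiveSpace n k).left} {T : Set F} {W : Fin n → F.IdealSheafData} {x : F}
    (h : IsNDFrameAt n k ρ T W x) : IsFrameAt W x := by
  obtain ⟨w, g, h1, h2, h3, -, -⟩ := h
  exact ⟨w, h1, h2, h3⟩

/-- **THE CANDIDATE DOWNSTAIRS INVARIANT `NDInv m F ρ T`** (see the section docstring). [OURS · L1 W4.5b · candidate; parametric use through §13.9] -/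
def NDInv (m : ℕ) (F : AlgebraicGeometry.Scheme.{0}) (ρ : F ⟶ (Literature.AlgebraicGeometry.Motives.projectiveSpace n k).left) (T : Set F) : Prop :=
  Literature.AlgebraicGeometry.Resolution.Scheme.IsRegular F ∧
  ∃ S : Finset F, S.card = m ∧
    (∀ z : ↥(AlgebraicGeometry.Scheme.IdealSheafData.vanishingIdeal (⟨closure T, isClosed_closure⟩ : TopologicalSpace.Closeds F)).subscheme, IsRegularLocalRing ((AlgebraicGeometry.Scheme.IdealSheafData.vanishingIdeal (⟨closure T, isClosed_closure⟩ : TopologicalSpace.Closeds F)).subscheme.presheaf.stalk z) ↔ ((AlgebraicGeometry.Scheme.IdealSheafData.vanishingIdeal (⟨closure T, isClosed_closure⟩ : TopologicalSpace.Closeds F)).subschemeι z : F) ∉ S) ∧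
    (∀ x ∈ S, (∃ z : ↥(AlgebraicGeometry.Scheme.IdealSheafData.vanishingIdeal (⟨closure T, isClosed_closure⟩ : TopologicalSpace.Closeds F)).subscheme, ((AlgebraicGeometry.Scheme.IdealSheafData.vanishingIdeal (⟨closure T, isClosed_closure⟩ : TopologicalSpace.Closeds F)).subschemeι z : F) = x) ∧ IsClosed ({x} : Set F) ∧
      ∃ W : Fin n → F.IdealSheafData, IsNDFrameAt n k ρ T W x)

/-- **(B4-end) PROVED**: at measure `0` the reduced closure of `T` is regular. [OURS · L1 W4.5b] -/
theorem ndInv_end (F : AlgebraicGeometry.Scheme.{0}) (ρ : F ⟶ (Literature.AlgebraicGeometry.Motives.projectiveSpace n k).left) (T : Set F) (h : NDInv n k 0 F ρ T) :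
    Literature.AlgebraicGeometry.Resolution.Scheme.IsRegular (AlgebraicGeometry.Scheme.IdealSheafData.vanishingIdeal (⟨closure T, isClosed_closure⟩ : TopologicalSpace.Closeds F)).subscheme := by
  obtain ⟨-, S, hS, hreg, -⟩ := h
  have hS' : S = ∅ := Finset.card_eq_zero.mp hS
  intro z
  exact (hreg z).mpr (by simp [hS'])

end NDInvariant

/-! ## 13.12 (B4-round) SPLIT (desk R31/DEAL «ND-K5» (β): «idea-1 types the split as sorried sub-signatures with the composition PROVED»):
(B4α′) `RoundAtNDFrame` — THE TORIC HEART at one ND frame: after any blow-up of the closed point `x` carrying local ND frame data `(W, g)`, a strata tower from the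
stepped frame boundary EXISTS, with regular top floor, closed strict-transform set, END (the reduced closure regular over `x`), ISO off `x`, and exact bookkeeping of
`T` off `x` (inside: (B4α) the standard tower over `𝔸ⁿ_k` along the won play of `g` — lead-2's ND dictionary `e1_along_play` / `not_bad_coordinateFace` /
`end_order_one_of_wonPlay` + companion §12.16 — and (B4β) its étale transport along the frame chart `t ↦ w`, `IsBlowup.of_isPullback_of_flat`, `StrictTransformBaseChange`);
(B4β′) `NDInvPersists` — BOOKKEEPING: such a tower takes `NDInv (m+1)` to `NDInv m` (the other non-regular points and their ND frame data move along the isomorphism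
off `x`; no new non-regular point over `x`).  `ndInv_round_of : RoundAtNDFrame → NDInvPersists → RoundFacts n k (NDInv n k)` is PROVED. -/

section RoundSplit

variable (n : ℕ) (k : Type) [Field k]

/-- **(B4α′) as a Prop**: the local round at an ND frame (see the section docstring). [OURS · L1 W4.5b · statement] -/
def RoundAtNDFrame : Prop :=
  ∀ (F₁ : AlgebraicGeometry.Scheme.{0}) (ρ : F₁ ⟶ (Literature.AlgebraicGeometry.Motives.projectiveSpace n k).left) (T₁ : Set F₁),
    Literature.AlgebraicGeometry.Resolution.Scheme.IsRegular F₁ → IsClosed T₁ →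
    ∀ (x : F₁) (hx : IsClosed ({x} : Set F₁)) (W : Fin n → F₁.IdealSheafData), IsNDFrameAt n k ρ T₁ W x →
    ∀ (F₂ : AlgebraicGeometry.Scheme.{0}) (υ : F₂ ⟶ F₁),
      Literature.AlgebraicGeometry.Resolution.IsBlowup υ
        (AlgebraicGeometry.Scheme.IdealSheafData.vanishingIdeal (⟨{x}, hx⟩ : TopologicalSpace.Closeds F₁)) →
      ∃ (F₉ : AlgebraicGeometry.Scheme.{0}) (β : F₉ ⟶ F₂) (T₉ : Set F₉),
        StrataTower F₂ ((frameBoundary W).stepAlong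
            (AlgebraicGeometry.Scheme.IdealSheafData.vanishingIdeal (⟨{x}, hx⟩ : TopologicalSpace.Closeds F₁)) 1 υ)
          (closure (υ ⁻¹' (T₁ \ {x}))) F₉ β T₉ ∧
        Literature.AlgebraicGeometry.Resolution.Scheme.IsRegular F₉ ∧ IsClosed T₉ ∧
        (∀ z : ↥(AlgebraicGeometry.Scheme.IdealSheafData.vanishingIdeal (⟨closure T₉, isClosed_closure⟩ : TopologicalSpace.Closeds F₉)).subscheme, ((AlgebraicGeometry.Scheme.IdealSheafData.vanishingIdeal (⟨closure T₉, isClosed_closure⟩ : TopologicalSpace.Closeds F₉)).subschemeι z : F₉) ∈ (β ≫ υ) ⁻¹' {x} →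
          IsRegularLocalRing ((AlgebraicGeometry.Scheme.IdealSheafData.vanishingIdeal (⟨closure T₉, isClosed_closure⟩ : TopologicalSpace.Closeds F₉)).subscheme.presheaf.stalk z)) ∧
        CategoryTheory.IsIso ((β ≫ υ) ∣_ (⟨{x}ᶜ, hx.isOpen_compl⟩ : F₁.Opens)) ∧
        T₉ ∩ (β ≫ υ) ⁻¹' {x}ᶜ = (β ≫ υ) ⁻¹' (T₁ \ {x})

/-- **(B4β′) as a Prop**: persistence of `NDInv` through a round (see the section docstring). [OURS · L1 W4.5b · statement] -/
def NDInvPersists : Prop :=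
  ∀ (m : ℕ) (F₁ : AlgebraicGeometry.Scheme.{0}) (ρ : F₁ ⟶ (Literature.AlgebraicGeometry.Motives.projectiveSpace n k).left) (T₁ : Set F₁), NDInv n k (m + 1) F₁ ρ T₁ →
    ∀ (x : F₁) (hx : IsClosed ({x} : Set F₁)),
      (∃ z : ↥(AlgebraicGeometry.Scheme.IdealSheafData.vanishingIdeal (⟨closure T₁, isClosed_closure⟩ : TopologicalSpace.Closeds F₁)).subscheme, ((AlgebraicGeometry.Scheme.IdealSheafData.vanishingIdeal (⟨closure T₁, isClosed_closure⟩ : TopologicalSpace.Closeds F₁)).subschemeι z : F₁) = x ∧ ¬ IsRegularLocalRing ((AlgebraicGeometry.Scheme.IdealSheafData.vanishingIdeal (⟨closure T₁, isClosed_closure⟩ : TopologicalSpace.Closeds F₁)).subscheme.presheaf.stalk z)) →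
    ∀ (F₂ : AlgebraicGeometry.Scheme.{0}) (υ : F₂ ⟶ F₁),
      Literature.AlgebraicGeometry.Resolution.IsBlowup υ
        (AlgebraicGeometry.Scheme.IdealSheafData.vanishingIdeal (⟨{x}, hx⟩ : TopologicalSpace.Closeds F₁)) →
    ∀ (F₉ : AlgebraicGeometry.Scheme.{0}) (β : F₉ ⟶ F₂) (T₉ : Set F₉),
      Literature.AlgebraicGeometry.Resolution.Scheme.IsRegular F₉ → IsClosed T₉ →
      (∀ z : ↥(AlgebraicGeometry.Scheme.IdealSheafData.vanishingIdeal (⟨closure T₉, isClosed_closure⟩ : TopologicalSpace.Closeds F₉)).subscheme, ((AlgebraicGeometry.Scheme.IdealSheafData.vanishingIdeal (⟨closure T₉, isClosed_closure⟩ : TopologicalSpace.Closeds F₉)).subschemeι z : F₉) ∈ (β ≫ υ) ⁻¹' {x} →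
        IsRegularLocalRing ((AlgebraicGeometry.Scheme.IdealSheafData.vanishingIdeal (⟨closure T₉, isClosed_closure⟩ : TopologicalSpace.Closeds F₉)).subscheme.presheaf.stalk z)) →
      CategoryTheory.IsIso ((β ≫ υ) ∣_ (⟨{x}ᶜ, hx.isOpen_compl⟩ : F₁.Opens)) →
      T₉ ∩ (β ≫ υ) ⁻¹' {x}ᶜ = (β ≫ υ) ⁻¹' (T₁ \ {x}) →
      NDInv n k m F₉ ((β ≫ υ) ≫ ρ) T₉

/-- **THE COMPOSITION, PROVED**: (B4α′) + (B4β′) ⇒ (B4-round).  Needs `IsClosed T₁`, which `NDInv` does not record — so it is taken through the invariant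
`NDInvC m F ρ T := NDInv m F ρ T ∧ IsClosed T`?  No: K5′'s rounds start at `T = range ι` (closed) and every tower returns a CLOSED `T₉` ((B4α′) clause), so we
simply run §13.9 with the closed variant `NDInvC` (below) — `hres_of_rounds` is parametric. [OURS · L1 W4.5b] -/
def NDInvC (m : ℕ) (F : AlgebraicGeometry.Scheme.{0}) (ρ : F ⟶ (Literature.AlgebraicGeometry.Motives.projectiveSpace n k).left) (T : Set F) : Prop :=
  NDInv n k m F ρ T ∧ IsClosed T

/-- (B4-end) for `NDInvC`: at measure `0` the reduced closure is regular. [OURS · PROVED] -/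
theorem ndInvC_end (F : AlgebraicGeometry.Scheme.{0}) (ρ : F ⟶ (Literature.AlgebraicGeometry.Motives.projectiveSpace n k).left) (T : Set F) (h : NDInvC n k 0 F ρ T) :
    Literature.AlgebraicGeometry.Resolution.Scheme.IsRegular (AlgebraicGeometry.Scheme.IdealSheafData.vanishingIdeal (⟨closure T, isClosed_closure⟩ : TopologicalSpace.Closeds F)).subscheme :=
  ndInv_end n k F ρ T h.1

/-- **(B4-round) COMPOSITION, PROVED**: the local round at an ND frame (B4α′) and persistence (B4β′) give `RoundFacts n k (NDInvC n k)`. [OURS · pure logic] -/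
theorem ndInv_round_of (hα : RoundAtNDFrame n k) (hβ : NDInvPersists n k) : RoundFacts n k (NDInvC n k) := by
  intro m F₁ ρ T₁ h
  obtain ⟨⟨hreg, S, hcard, hiff, hS⟩, hT₁⟩ := h
  obtain ⟨x, hxS⟩ := Finset.card_pos.mp (by omega : 0 < S.card)
  obtain ⟨⟨z, hz⟩, hxcl, W, hW⟩ := hS x hxS
  subst hz
  have hnreg : ¬ IsRegularLocalRing ((AlgebraicGeometry.Scheme.IdealSheafData.vanishingIdeal (⟨closure T₁, isClosed_closure⟩ : TopologicalSpace.Closeds F₁)).subscheme.presheaf.stalk z) := fun hr => (hiff z).mp hr hxS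
  refine ⟨z, hxcl, hnreg, hreg _, fun F₂ υ hυ => ?_⟩
  obtain ⟨F₉, β, T₉, htower, hreg₉, hT₉, hend, hiso, hbook⟩ := hα F₁ ρ T₁ hreg hT₁ _ hxcl W hW F₂ υ hυ
  refine ⟨F₉, β, T₉, ⟨hxcl, W, isFrameAt_of_isNDFrameAt n k hW, htower⟩, m, le_refl m, ?_, hT₉⟩
  exact hβ m F₁ ρ T₁ ⟨hreg, S, hcard, hiff, hS⟩ _ hxcl ⟨z, rfl, hnreg⟩ F₂ υ hυ F₉ β T₉ hreg₉ hT₉ hend hiso hbook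

end RoundSplit

end Summit.ResolutionOfSingularities.ResolutionOfSingularities.Cruxes.EquisingularLiftNat.Sections.ND

end
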